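/-
Origin: expansion seat `prover-pub-hodgecm-own-htheta-g2-0`, handover #H20 2026-08-21T13:03:19Z md5 03a28e9ad559 (76 l.; NEW additive MODEL leaf — ROW 9 AT FACES MODULO THE SAME CITED MANIFEST AS THE RECORD: theorem `HodgeCM.Model.theta_subset_Uiso_face_r20JBUARM (hHD hI h₁ h₃) (hGRU : «U» :60–:63 shape verbatim) (h418 : «JBUARM» :41–:44 shape verbatim) (F : CMField) [IsGalois ℚ F] (h6 : 6 ≤ finrank ℚ F) (f : Face F) {ι₁} (hadm : f.Admissible ι₁) (hcan) (V : HermSpace3 F ι₁) : ∃ D, (R_E.GoodCtx ι₁ (faceCtx F f ι₁ D) ∧ SInstance.GOG V (faceCtx F f ι₁ D)) ∧ ∀ i : Fin 4, ∃ Γ₀, ∀ Γ ≤ Γ₀, R_E.Theta V (faceCtx F f ι₁ D) i Γ ⊆ U.Uiso Γ F (f.psi i) ι₁`, R_E = E's OWN `thetaModelOf …` term at own-mu's μ₀; author htheta-x1 under own-htheta; imports «JBUARM» (#H12) + #H19; 1 theorem, 0 `def … : Prop`, nothing new cited; NOT an E term. CERT rc 0 ∕ trio as in the header; ROWDEPS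 #H12 #H19; NAME for audit: HodgeCM.Model.theta_subset_Uiso_face_r20JBUARM) (`HOME/pub-hodgecm-own-htheta/stage77/HodgeCM/Model/HThetaFaceOfRecord.lean`, md5 03a28e9ad559, 76 lines);
landed by the p-seat packager p gen 32 (p-g32) in gate run 77 as `HodgeCM/Model/HThetaFaceOfRecord.lean` (verbatim).
-/
/-
Copyright (c) 2026 the pub-hodgecm formalisation cell (harness21).  New file, not vendored.  x1 work file (a draft until own-htheta kits it).
Origin: seat `prover-pub-hodgecm-htheta-x1-0` (unit pub-hodgecm-htheta-x1, EOD SURGE (1a) extra prover x1 UNDER own-htheta), 2026-08-21 —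
E-SHAPED FACE FORM of row 9: the additive sequel of #H18 `Model/HThetaJunctionFace` ∕ #H19 `Model/HThetaJunctionFaceUiso` (x1, kitted by own-htheta)
instantiated at E's OWN end-state theta model, with EXACTLY the two binder groups of the E term of record «JBUARM»
(`Model/E2InstanceOGR20AEPISTR2DJWHHTCGJBUARM.lean`:36): `hGRU` (CITE [GR91 Prop. 3.1.1]) and `h418` (CITE [Liu 2021 Thm 4.18, combined reading r8]).
Imports «JBUARM» (for E's vocabulary: `thetaModelOf ∕ embOf ∕ coverOf ∕ wmOfInput ∕ thetaOf ∕ d12Of ∕ d34Of`, own-mu's closed `μ`, the two `_holds` strikes)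
+ #H19.  KERNEL ONLY: 1 theorem, no proof holes, nothing new cited, NOT an E term (its conclusion is the face statement, not `PerL`);
nothing here is a claim of the manuscripts under adjudication.

WHAT IT IS — `HodgeCM.Model.theta_subset_Uiso_face_r20JBUARM`: for every Galois CM field `F` with `6 ≤ [F:ℚ]`, every rank-four face `f` of `F`, every
admissible `ι₁` with `(mk ι₁).embedding = ι₁` (automatic at a place's embedding) and every `V : HermSpace3 F ι₁`, E's OWN theta model
`R_E := thetaModelOf hHD hI h₁ h₃′ (orientBitι F ι₁) (embOf …) (coverOf … arapura2012_cor_15_4_6_holds) (wmOfInput (HypCensus.Wcm (SInstance.GRU.hGR hGRU) …))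
(thetaOf _ (thetaClassInputOf _ (fun V c => thetaSpaceInputOf … (SInstance.SROGT'C …GRU… (muSharp₂₃ muSlotZero) …) V c))) (d12Of μ₀) (d34Of μ₀)` (the term displayed
VERBATIM inside «U» :66–:72 ∕ «UARM» :64–:70, read at `L := F`) has seesaw lines `D` at the face with BOTH guards (`R_E.GoodCtx ι₁ c`, `SInstance.GOG V c`,
`c := faceCtx F f ι₁ D`) and, for every slot `i`, a level `Γ₀` below which `R_E.Theta V c i Γ ⊆ U.Uiso Γ F (f.psi i) ι₁` — from `hGRU` and `h418` ALONE
(`hA ↦ arapura2012_cor_15_4_6_holds`, `hR ↦ deligneMilne1982_Thm_6_20_full_holds`, `μ ↦ ArchSideTerm.muSharp₂₃ @ArchSideTerm.muSlotZero`, `hRΘ` by `subset_rfl`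
as in «JB» :95).  This is the hΘ row TRANSPOSED TO FACES modulo the cited manifest of the stage-1 record — the `Theta_sub`-shaped half of a face theta
datum; the non-vanishing ∕ wedge ∕ coupling halves are the theta side's and are NOT supplied here.
-/
import Summits.HodgeConjecture.HodgeCM.Model.E2InstanceOGR20AEPISTR2DJWHHTCGJBUARM
import Summits.HodgeConjecture.HodgeCM.Model.HThetaJunctionFaceUiso

/-! PORT of `HodgeCM/Model/HThetaFaceOfRecord.lean` (HodgeCMPerL run 82) — verbatim mechanical port; provenance in the PORT header line. -/

set_option autoImplicit false

noncomputable section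

namespace HodgeCM

namespace Model

open NumberField NumberField.InfinitePlace
open HodgeCM.Model.ArchSideTerm
open HodgeCM.Universe (AdelicThetaCore AdelicThetaCore₀ SideData ThetaModel ModelAxiomsPerL)
open Literature.AlgebraicGeometry.HodgeTheory
open Literature.NumberTheory.Automorphic.PicardCM
open Literature.NumberTheory.Transcendental
open Literature.NumberTheory.GelbartRogawski1991.UnitaryDualPair
open HodgeCM.Model.ThetaSpace

variable (hHD : exists_isReal_hodgeModel) (hI : hodgePQ_independent_of_hodgeModel)
  (h₁ : BallQuotientUniformised) (h₃ : CMAbelianVarietyEigenbasisRealised)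

/-- **ROW 9 AT A FACE, MODULO THE CITED MANIFEST OF THE RECORD** (binder groups `hGRU` [GR91 Prop. 3.1.1] + `h418` [Liu 2021 Thm 4.18 r8] — the two
groups of «JBUARM», nothing else): for `F` Galois CM with `6 ≤ [F:ℚ]`, a face `f`, an admissible `ι₁` with the canonical-representative clause, and any
`V`, E's own end-state theta model at `(F, ι₁)` has seesaw lines `D` at the face context carrying BOTH guards, and its theta classes of each slot type
lie in `U_{(F, f.psi i, ι₁)}(Γ)` for all small levels `Γ`.  ONE application of x1's #H19 `SInstance.exists_faceCtx_theta_subset_Uiso` at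
`C := coreOf _ (embOf …) (coverOf …) (wmOfInput …) (thetaOf …)`, `d12 ∕ d34 := d12Of ∕ d34Of μ₀`, pin section `:= SInstance.GRU.hGR… hGRU`, `μ := μ₀`,
`hΔ := ArchSideTerm.hΔ_GOG_muSharp₂₃ …`, `hR := deligneMilne1982_Thm_6_20_full_holds`, `hRΘ := subset_rfl`, `h418 := h418 V hcan`. [folklore] -/
theorem theta_subset_Uiso_face_r20JBUARM
    (hGRU : ∀ (L : Type) [Field L] [NumberField L] [NumberField.IsCMField L] {N M n : ℕ} (e : Fin N × Fin M ≃ Fin n)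
      (dV : Fin N → L) (hdV : ∀ i, NumberField.IsCMField.complexConj L (dV i) = dV i) (hdV0 : ∀ i, dV i ≠ 0)
      (dW : Fin M → L) (hdW : ∀ i, NumberField.IsCMField.complexConj L (dW i) = dW i) (hdW0 : ∀ i, dW i ≠ 0),
      (cmSplittingDatum L e dV hdV hdV0 dW hdW hdW0).CompatibleSplitting)
    (h418 : ∀ {L : CMField} {ι₁ : L →+* ℂ} (V : HermSpace3 L ι₁), (NumberField.InfinitePlace.mk ι₁).embedding = ι₁ → ∀ a₀ : LiuIndex.RealScalar L,
      (liuDictionaryPin hHD hI h₁ (cmAbelianVarietyRealised_of_eigenbasis hHD hI h₃) Literature.NumberTheory.Transcendental.arapura2012_cor_15_4_6_holds V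
          (LiuIndex.I V (LiuIndex.repAt a₀) (LiuIndex.muLiu ι₁ LiuIndex.GramClass.rep))
          (LiuIndex.line V (LiuIndex.repAt a₀) (LiuIndex.muLiu ι₁ LiuIndex.GramClass.rep))).Thm418C)
    (F : CMField) [IsGalois ℚ F] (h6 : 6 ≤ Module.finrank ℚ F) (f : Face F) {ι₁ : F →+* ℂ} (hadm : f.Admissible ι₁)
    (hcan : (NumberField.InfinitePlace.mk ι₁).embedding = ι₁) (V : HermSpace3 F ι₁) :
    ∃ D : StubTree.SeesawDatum F,
      ((thetaModelOf hHD hI h₁ (cmAbelianVarietyRealised_of_eigenbasis hHD hI h₃) (orientBitι F ι₁) (embOf hHD hI h₁ (cmAbelianVarietyRealised_of_eigenbasis hHD hI h₃)) (coverOf hHD hI h₁ (cmAbelianVarietyRealised_of_eigenbasis hHD hI h₃) arapura2012_cor_15_4_6_holds) (wmOfInput (HypCensus.Wcm (@SInstance.GRU.hGR hGRU) (EtaChi.η (@SInstance.χVR (@SInstance.GRU.hGR hGRU) (@SInstance.GRU.hGR₀ hGRU) (@SInstance.GRU.hGR₁ hGRU)) (@SInstance.χWR (@SInstance.GRU.hGR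 hGRU) (@SInstance.GRU.hGR₀ hGRU) (@SInstance.GRU.hGR₁ hGRU) (ArchSideTerm.muSharp₂₃ @ArchSideTerm.muSlotZero))) (EtaChi.hη (@SInstance.χVR (@SInstance.GRU.hGR hGRU) (@SInstance.GRU.hGR₀ hGRU) (@SInstance.GRU.hGR₁ hGRU)) (@SInstance.χWR (@SInstance.GRU.hGR hGRU) (@SInstance.GRU.hGR₀ hGRU) (@SInstance.GRU.hGR₁ hGRU) (ArchSideTerm.muSharp₂₃ @ArchSideTerm.muSlotZero))) (EtaChi.hηc (@SInstance.χVR (@SInstance.GRU.hGR hGRU) (@SInstance.GRU.hGR₀ hGRU) (@SInstance.GRU.hGR₁ hGRU)) (@SInstance.χWR (@SInstance.GRU.hGR hGRU) (@SInstance.GRU.hGR₀ hGRU) (@SInstance.GRU.hGR₁ hGRU) (ArchSideTerm.muSharp₂₃ @ArchSideTerm.muSlotZero))))) (thetaOf _ (thetaClassInputOf _ (fun V c => thetaSpaceInputOf hHD hI h₁ (cmAbelianVarietyRealised_of_eigenbasis hHD hI h₃) (SInstance.SROGT'C (@SInstance.GRU.hGR hGRU) (@SInstance.GRU.hGR₀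 hGRU) (@SInstance.GRU.hGR₁ hGRU) (@SInstance.GRU.hGR₂ hGRU) (@SInstance.GRU.hGR₃ hGRU) (ArchSideTerm.muSharp₂₃ @ArchSideTerm.muSlotZero) (ArchSideTerm.hΔ₁_GOG_muSharp₂₃ (@SInstance.GRU.hGR hGRU) (@SInstance.GRU.hGR₀ hGRU) (@SInstance.GRU.hGR₁ hGRU) (@SInstance.GRU.hGR₂ hGRU) (@SInstance.GRU.hGR₃ hGRU) @ArchSideTerm.muSlotZero) (ArchSideTerm.hΔ₂_GOG_muSharp₂₃ (@SInstance.GRU.hGR hGRU) (@SInstance.GRU.hGR₀ hGRU) (@SInstance.GRU.hGR₁ hGRU) (@SInstance.GRU.hGR₂ hGRU) (@SInstance.GRU.hGR₃ hGRU) @ArchSideTerm.muSlotZero (ArchSideTerm.hSV_holds (@SInstance.GRU.hGR hGRU))) (ArchSideTerm.hΔ₃_GOG_muSharp₂₃ (@SInstance.GRU.hGR hGRU) (@SInstance.GRU.hGR₀ hGRU) (@SInstance.GRU.hGR₁ hGRU) (@SInstance.GRU.hGR₂ hGRU) (@SInstance.GRU.hGR₃ hGRU) @ArchSideTerm.muSlotZero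 (ArchSideTerm.hSV_holds (@SInstance.GRU.hGR hGRU)))) V c))) (d12Of (ArchSideTerm.muSharp₂₃ @ArchSideTerm.muSlotZero)) (d34Of (ArchSideTerm.muSharp₂₃ @ArchSideTerm.muSlotZero))).GoodCtx ι₁ (faceCtx F f ι₁ D) ∧ SInstance.GOG V (faceCtx F f ι₁ D)) ∧
      ∀ i : Fin 4, ∃ Γ₀ : Level V, ∀ Γ ≤ Γ₀,
        (thetaModelOf hHD hI h₁ (cmAbelianVarietyRealised_of_eigenbasis hHD hI h₃) (orientBitι F ι₁) (embOf hHD hI h₁ (cmAbelianVarietyRealised_of_eigenbasis hHD hI h₃)) (coverOf hHD hI h₁ (cmAbelianVarietyRealised_of_eigenbasis hHD hI h₃) arapura2012_cor_15_4_6_holds) (wmOfInput (HypCensus.Wcm (@SInstance.GRU.hGR hGRU) (EtaChi.η (@SInstance.χVR (@SInstance.GRU.hGR hGRU) (@SInstance.GRU.hGR₀ hGRU) (@SInstance.GRU.hGR₁ hGRU)) (@SInstance.χWR (@SInstance.GRU.hGR hGRU) (@SInstance.GRU.hGR₀ hGRU) (@SInstance.GRU.hGR₁ hGRU) (ArchSideTerm.muSharp₂₃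 @ArchSideTerm.muSlotZero))) (EtaChi.hη (@SInstance.χVR (@SInstance.GRU.hGR hGRU) (@SInstance.GRU.hGR₀ hGRU) (@SInstance.GRU.hGR₁ hGRU)) (@SInstance.χWR (@SInstance.GRU.hGR hGRU) (@SInstance.GRU.hGR₀ hGRU) (@SInstance.GRU.hGR₁ hGRU) (ArchSideTerm.muSharp₂₃ @ArchSideTerm.muSlotZero))) (EtaChi.hηc (@SInstance.χVR (@SInstance.GRU.hGR hGRU) (@SInstance.GRU.hGR₀ hGRU) (@SInstance.GRU.hGR₁ hGRU)) (@SInstance.χWR (@SInstance.GRU.hGR hGRU) (@SInstance.GRU.hGR₀ hGRU) (@SInstance.GRU.hGR₁ hGRU) (ArchSideTerm.muSharp₂₃ @ArchSideTerm.muSlotZero))))) (thetaOf _ (thetaClassInputOf _ (fun V c => thetaSpaceInputOf hHD hI h₁ (cmAbelianVarietyRealised_of_eigenbasis hHD hI h₃) (SInstance.SROGT'C (@SInstance.GRU.hGR hGRU) (@SInstance.GRU.hGR₀ hGRU) (@SInstance.GRU.hGR₁ hGRU) (@SInstance.GRU.hGR₂ hGRU) (@SInstance.GRU.hGR₃ hGRU)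 (ArchSideTerm.muSharp₂₃ @ArchSideTerm.muSlotZero) (ArchSideTerm.hΔ₁_GOG_muSharp₂₃ (@SInstance.GRU.hGR hGRU) (@SInstance.GRU.hGR₀ hGRU) (@SInstance.GRU.hGR₁ hGRU) (@SInstance.GRU.hGR₂ hGRU) (@SInstance.GRU.hGR₃ hGRU) @ArchSideTerm.muSlotZero) (ArchSideTerm.hΔ₂_GOG_muSharp₂₃ (@SInstance.GRU.hGR hGRU) (@SInstance.GRU.hGR₀ hGRU) (@SInstance.GRU.hGR₁ hGRU) (@SInstance.GRU.hGR₂ hGRU) (@SInstance.GRU.hGR₃ hGRU) @ArchSideTerm.muSlotZero (ArchSideTerm.hSV_holds (@SInstance.GRU.hGR hGRU))) (ArchSideTerm.hΔ₃_GOG_muSharp₂₃ (@SInstance.GRU.hGR hGRU) (@SInstance.GRU.hGR₀ hGRU) (@SInstance.GRU.hGR₁ hGRU) (@SInstance.GRU.hGR₂ hGRU) (@SInstance.GRU.hGR₃ hGRU) @ArchSideTerm.muSlotZero (ArchSideTerm.hSV_holds (@SInstance.GRU.hGR hGRU)))) V c))) (d12Of (ArchSideTerm.muSharp₂₃ @ArchSideTerm.muSlotZero))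 (d34Of (ArchSideTerm.muSharp₂₃ @ArchSideTerm.muSlotZero))).Theta V (faceCtx F f ι₁ D) i Γ ⊆
          (picardCMUniverse hHD hI h₁ (cmAbelianVarietyRealised_of_eigenbasis hHD hI h₃)).Uiso Γ F (f.psi i) ι₁ :=
  SInstance.exists_faceCtx_theta_subset_Uiso hHD hI h₁ (cmAbelianVarietyRealised_of_eigenbasis hHD hI h₃)
    Literature.NumberTheory.Transcendental.arapura2012_cor_15_4_6_holds
    (@SInstance.GRU.hGR hGRU) (@SInstance.GRU.hGR₀ hGRU) (@SInstance.GRU.hGR₁ hGRU) (@SInstance.GRU.hGR₂ hGRU) (@SInstance.GRU.hGR₃ hGRU) (ArchSideTerm.muSharp₂₃ @ArchSideTerm.muSlotZero) (ArchSideTerm.hΔ₁_GOG_muSharp₂₃ (@SInstance.GRU.hGR hGRU) (@SInstance.GRU.hGR₀ hGRU) (@SInstance.GRU.hGR₁ hGRU) (@SInstance.GRU.hGR₂ hGRU) (@SInstance.GRU.hGR₃ hGRU) @ArchSideTerm.muSlotZero) (ArchSideTerm.hΔ₂_GOG_muSharp₂₃ (@SInstance.GRU.hGR hGRU) (@SInstance.GRU.hGR₀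 hGRU) (@SInstance.GRU.hGR₁ hGRU) (@SInstance.GRU.hGR₂ hGRU) (@SInstance.GRU.hGR₃ hGRU) @ArchSideTerm.muSlotZero (ArchSideTerm.hSV_holds (@SInstance.GRU.hGR hGRU))) (ArchSideTerm.hΔ₃_GOG_muSharp₂₃ (@SInstance.GRU.hGR hGRU) (@SInstance.GRU.hGR₀ hGRU) (@SInstance.GRU.hGR₁ hGRU) (@SInstance.GRU.hGR₂ hGRU) (@SInstance.GRU.hGR₃ hGRU) @ArchSideTerm.muSlotZero (ArchSideTerm.hSV_holds (@SInstance.GRU.hGR hGRU)))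
    F f V (coreOf _ (embOf hHD hI h₁ (cmAbelianVarietyRealised_of_eigenbasis hHD hI h₃)) (coverOf hHD hI h₁ (cmAbelianVarietyRealised_of_eigenbasis hHD hI h₃) arapura2012_cor_15_4_6_holds) (wmOfInput (HypCensus.Wcm (@SInstance.GRU.hGR hGRU) (EtaChi.η (@SInstance.χVR (@SInstance.GRU.hGR hGRU) (@SInstance.GRU.hGR₀ hGRU) (@SInstance.GRU.hGR₁ hGRU)) (@SInstance.χWR (@SInstance.GRU.hGR hGRU) (@SInstance.GRU.hGR₀ hGRU) (@SInstance.GRU.hGR₁ hGRU) (ArchSideTerm.muSharp₂₃ @ArchSideTerm.muSlotZero))) (EtaChi.hη (@SInstance.χVR (@SInstance.GRU.hGR hGRU) (@SInstance.GRU.hGR₀ hGRU) (@SInstance.GRU.hGR₁ hGRU)) (@SInstance.χWR (@SInstance.GRU.hGR hGRU) (@SInstance.GRU.hGR₀ hGRU) (@SInstance.GRU.hGR₁ hGRU) (ArchSideTerm.muSharp₂₃ @ArchSideTerm.muSlotZero))) (EtaChi.hηc (@SInstance.χVR (@SInstance.GRU.hGR hGRU) (@SInstance.GRU.hGR₀ hGRU)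 (@SInstance.GRU.hGR₁ hGRU)) (@SInstance.χWR (@SInstance.GRU.hGR hGRU) (@SInstance.GRU.hGR₀ hGRU) (@SInstance.GRU.hGR₁ hGRU) (ArchSideTerm.muSharp₂₃ @ArchSideTerm.muSlotZero))))) (thetaOf _ (thetaClassInputOf _ (fun V c => thetaSpaceInputOf hHD hI h₁ (cmAbelianVarietyRealised_of_eigenbasis hHD hI h₃) (SInstance.SROGT'C (@SInstance.GRU.hGR hGRU) (@SInstance.GRU.hGR₀ hGRU) (@SInstance.GRU.hGR₁ hGRU) (@SInstance.GRU.hGR₂ hGRU) (@SInstance.GRU.hGR₃ hGRU) (ArchSideTerm.muSharp₂₃ @ArchSideTerm.muSlotZero) (ArchSideTerm.hΔ₁_GOG_muSharp₂₃ (@SInstance.GRU.hGR hGRU) (@SInstance.GRU.hGR₀ hGRU) (@SInstance.GRU.hGR₁ hGRU) (@SInstance.GRU.hGR₂ hGRU) (@SInstance.GRU.hGR₃ hGRU) @ArchSideTerm.muSlotZero) (ArchSideTerm.hΔ₂_GOG_muSharp₂₃ (@SInstance.GRU.hGR hGRU) (@SInstance.GRU.hGR₀ hGRU) (@SInstance.GRU.hGR₁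 hGRU) (@SInstance.GRU.hGR₂ hGRU) (@SInstance.GRU.hGR₃ hGRU) @ArchSideTerm.muSlotZero (ArchSideTerm.hSV_holds (@SInstance.GRU.hGR hGRU))) (ArchSideTerm.hΔ₃_GOG_muSharp₂₃ (@SInstance.GRU.hGR hGRU) (@SInstance.GRU.hGR₀ hGRU) (@SInstance.GRU.hGR₁ hGRU) (@SInstance.GRU.hGR₂ hGRU) (@SInstance.GRU.hGR₃ hGRU) @ArchSideTerm.muSlotZero (ArchSideTerm.hSV_holds (@SInstance.GRU.hGR hGRU)))) V c)))) (d12Of (ArchSideTerm.muSharp₂₃ @ArchSideTerm.muSlotZero)) (d34Of (ArchSideTerm.muSharp₂₃ @ArchSideTerm.muSlotZero)) h6 hadm hcan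
    Literature.AlgebraicGeometry.HodgeTheory.deligneMilne1982_Thm_6_20_full_holds (fun _ _ _ => subset_rfl) (h418 V hcan)

end Model

end HodgeCM

end
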